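import Literature.MathematicalPhysics.QuantumManyBody.PeriodicTorusCalculus
import HarnessLib

/-!
# Periodic integration by parts for complex amplitudes and plane waves in one particle

Topic `Literature/MathematicalPhysics/QuantumManyBody`; companion of `PeriodicTorusCalculus.lean`.
On the torus `(ℝ³/Lℤ³)^N` (fundamental cell `cellN N L = [0,L)^{3N}`):

* **integration by parts** for `C¹` complex amplitudes that are `Lℤ³`-periodic in every
  particle, along an arbitrary direction `v ∈ (ℝ³)^N`: `∫ ∂_v G = 0`, `∫ F ∂_v G = -∫ (∂_v F) G`
  (Green's identity built on it is in `PuffCubicMomentOperator.lean`);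
* the **plane wave in one particle** `X ↦ e_m(x_l)` (`cellWave L m (X l)`, wave vector
  `k = 2πm/L`): its derivatives `∂_{x_j·w} e_m(x_l) = δ_{lj} i(k·w) e_m(x_l)`, in particular
  `∂_{j,a} e_m(x_l) = δ_{lj} i k_a e_m(x_l)` and `∂_{x_j·k} e_m(x_l) = δ_{lj} i‖k‖² e_m(x_l)`, the
  second derivatives, and the **Leibniz formula for the Laplacian of a modulated amplitude**
  `Δ(e_m(x_l) w) = e_m(x_l) (-‖k‖² w + 2i ∂_{x_l·k} w + Δw)` — the commutator
  `[-Δ, e^{ik·x_l}] = e^{ik·x_l}(‖k‖² - 2i k·∇_l)` behind the f-sum rule and Puff's cubic moment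
  [Stringari1995, §2.3];
* the **pair phase** `E_{jl} = eⱼēₗ`: `∂ⱼE_{jl} = iα_{jl}E_{jl}`, `∂ₗE_{jl} = -iα_{jl}E_{jl}` with
  `α_{jl} = ‖k‖²[j ≠ l]`.

All `[folklore]`; no definitions.
-/

noncomputable section

open MeasureTheory
open scoped ENNReal NNReal ComplexConjugate

namespace Literature.MathematicalPhysics.QuantumManyBody.BoseGas

variable {N : ℕ}

/-! ### Periodic integration by parts for complex functions -/

section ByParts

variable {L : ℝ}

/-- **Periodic integration by parts, complex-valued**: `∫_{[0,L)^{3N}} ∂_v G = 0` for a `C¹`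
complex-valued function that is `Lℤ³`-periodic in every particle and any direction
`v ∈ (ℝ³)^N`. [folklore] -/
theorem integral_cellN_fderiv_apply_eq_zero (hL : 0 < L) {G : Config N → ℂ} (hG : ContDiff ℝ 1 G)
    (hper : ∀ (X : Config N) (i : Fin N) (c : Fin 3),
      G (X + Pi.single i (EuclideanSpace.single c L)) = G X)
    (v : Config N) :
    ∫ X in cellN N L, fderiv ℝ G X v = 0 := by
  have hGd : Differentiable ℝ G := hG.differentiable one_ne_zero
  have hpart : ∀ (T : ℂ →L[ℝ] ℝ), ∫ X in cellN N L, T (fderiv ℝ G X v) = 0 := by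
    intro T
    have hg : ContDiff ℝ 1 (fun Y => T (G Y)) := T.contDiff.comp hG
    have hgper : IsLatticePeriodic L (fun Y => T (G Y)) := fun Y i c => by
      show T (G (Y + Pi.single i (EuclideanSpace.single c L))) = T (G Y)
      rw [hper Y i c]
    have hderiv : ∀ Y, T (fderiv ℝ G Y v) =
        ∑ j : Fin N, ∑ c : Fin 3, v j c * pderiv j c (fun Z => T (G Z)) Y := by
      intro Y
      rw [fderiv_apply_eq_sum, map_sum]
      refine Finset.sum_congr rfl fun j _ => ?_
      rw [map_sum]
      refine Finset.sum_congr rfl fun c _ => ?_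
      have hT : HasFDerivAt (fun Z => T (G Z)) (T.comp (fderiv ℝ G Y)) Y :=
        T.hasFDerivAt.comp Y (hGd Y).hasFDerivAt
      rw [map_smul, smul_eq_mul, pderiv, hT.fderiv]
      rfl
    simp_rw [hderiv]
    rw [integral_finsetSum _ fun j _ => integrable_finsetSum _ fun c _ =>
      ((integrableOn_cellN (continuous_pderiv hg j c) L).const_mul _)]
    refine Finset.sum_eq_zero fun j _ => ?_
    rw [integral_finsetSum _ fun c _ =>
      ((integrableOn_cellN (continuous_pderiv hg j c) L).const_mul _)]
    refine Finset.sum_eq_zero fun c _ => ?_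
    rw [integral_const_mul, integral_cellN_pderiv_eq_zero hL hg hgper j c, mul_zero]
  have hint : Integrable (fun X => fderiv ℝ G X v) (volume.restrict (cellN N L)) :=
    integrableOn_cellN (continuous_fderiv_apply_const hG _) L
  apply Complex.ext
  · rw [Complex.zero_re, ← Complex.reCLM_apply, ← ContinuousLinearMap.integral_comp_comm _ hint]
    exact hpart Complex.reCLM
  · rw [Complex.zero_im, ← Complex.imCLM_apply, ← ContinuousLinearMap.integral_comp_comm _ hint]
    exact hpart Complex.imCLM

/-- **Periodic integration by parts, product form**: `∫ F ∂_v G = -∫ (∂_v F) G` on the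
fundamental cell, for `C¹` complex `Lℤ³`-periodic `F, G` and any direction `v`. [folklore] -/
theorem integral_cellN_mul_fderiv_apply (hL : 0 < L) {F G : Config N → ℂ}
    (hF : ContDiff ℝ 1 F) (hG : ContDiff ℝ 1 G)
    (hFper : ∀ (X : Config N) (i : Fin N) (c : Fin 3),
      F (X + Pi.single i (EuclideanSpace.single c L)) = F X)
    (hGper : ∀ (X : Config N) (i : Fin N) (c : Fin 3),
      G (X + Pi.single i (EuclideanSpace.single c L)) = G X)
    (v : Config N) :
    ∫ X in cellN N L, F X * fderiv ℝ G X v = -∫ X in cellN N L, fderiv ℝ F X v * G X := by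
  have hFd := hF.differentiable one_ne_zero
  have hGd := hG.differentiable one_ne_zero
  have h0 := integral_cellN_fderiv_apply_eq_zero hL (hF.mul hG)
    (fun X i c => by simp only [hFper X i c, hGper X i c]) v
  simp_rw [fderiv_mul_apply (hFd _) (hGd _)] at h0
  have hi1 : IntegrableOn (fun X => fderiv ℝ F X v * G X) (cellN N L) :=
    integrableOn_cellN ((continuous_fderiv_apply_const hF _).mul hG.continuous) L
  have hi2 : IntegrableOn (fun X => F X * fderiv ℝ G X v) (cellN N L) :=
    integrableOn_cellN (hF.continuous.mul (continuous_fderiv_apply_const hG _)) L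
  rw [integral_add hi1 hi2] at h0
  linear_combination h0

end ByParts

/-! ### Plane waves in one particle -/

section PlaneWave

variable (L : ℝ) (m : Fin 3 → ℤ)

/-- The map `X ↦ e_m(x_l)` has derivative `e_m(x_l) (2πi/L)(m·w)` along `Pi.single l w` and `0`
along the other particles. [folklore] -/
theorem hasFDerivAt_cellWave_comp_apply (l : Fin N) (X : Config N) :
    HasFDerivAt (fun Y : Config N => cellWave L m (Y l))
      ((cellWave L m (X l) • ((2 * Real.pi * Complex.I / L) •
        (Complex.ofRealCLM.comp (∑ k : Fin 3, (m k : ℝ) •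
          PiLp.proj (𝕜 := ℝ) 2 (fun _ : Fin 3 => ℝ) k)))).comp (ContinuousLinearMap.proj l)) X := by
  have h := (hasFDerivAt_cellWave L m (X l)).comp X (hasFDerivAt_apply (𝕜 := ℝ) l X)
  exact h

/-- `X ↦ e_m(x_l)` is `Cⁿ`. [folklore] -/
theorem contDiff_cellWave_comp_apply {n : ℕ∞} (l : Fin N) :
    ContDiff ℝ n (fun Y : Config N => cellWave L m (Y l)) :=
  ((contDiff_cellWave L m).of_le (by exact_mod_cast le_top)).comp (contDiff_apply ℝ Space l)

/-- `X ↦ e_m(x_l)` is differentiable. [folklore] -/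
theorem differentiable_cellWave_comp_apply (l : Fin N) :
    Differentiable ℝ (fun Y : Config N => cellWave L m (Y l)) := fun X =>
  (hasFDerivAt_cellWave_comp_apply L m l X).differentiableAt

/-- `X ↦ e_m(x_l)` is invariant under every lattice translation of every particle. [folklore] -/
theorem cellWave_comp_apply_add_single_latticeVec {L : ℝ} (hL : L ≠ 0) (m : Fin 3 → ℤ)
    (l : Fin N) (X : Config N) (i : Fin N) (n : Fin 3 → ℤ) :
    cellWave L m ((X + Pi.single i (latticeVec L n) : Config N) l) = cellWave L m (X l) := by
  rw [Pi.add_apply]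
  by_cases hli : l = i
  · subst hli
    rw [Pi.single_eq_same]
    exact periodic_latticeVec (fun x c => cellWave_periodic hL m x c) (X l) n
  · rw [Pi.single_eq_of_ne hli, add_zero]

/-- **The density-wave derivative of a plane wave in one particle**: with `k = 2πm/L`,
`∂_{x_j·w} e_m(x_l) = δ_{lj} · i (k·w) · e_m(x_l)`. [folklore] -/
theorem fderiv_cellWave_comp_apply_eq (l j : Fin N) (X : Config N) (w : Space) {k : Space}
    (hk : k = (2 * Real.pi / L) • latticeVec 1 m) :
    fderiv ℝ (fun Y : Config N => cellWave L m (Y l)) X (Pi.single j w) =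
      if l = j then Complex.I * ((∑ c : Fin 3, k c * w c : ℝ) : ℂ) * cellWave L m (X l) else 0 := by
  rw [(hasFDerivAt_cellWave_comp_apply L m l X).fderiv, ContinuousLinearMap.comp_apply,
    ContinuousLinearMap.proj_apply, Pi.single_apply]
  split_ifs with hlj
  · rw [FunLike.coe_smul, FunLike.coe_smul, Pi.smul_apply, Pi.smul_apply, ← sum_coord_eq_clm]
    simp only [smul_eq_mul, hk, PiLp.smul_apply, latticeVec, one_mul]
    push_cast
    simp only [Finset.mul_sum, Finset.sum_mul]
    refine Finset.sum_congr rfl fun c _ => ?_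
    ring
  · simp

/-- `∂_{j,a} e_m(x_l) = δ_{lj} i k_a e_m(x_l)`. [folklore] -/
theorem fderiv_cellWave_comp_apply_single_single (l j : Fin N) (a : Fin 3) (X : Config N)
    {k : Space} (hk : k = (2 * Real.pi / L) • latticeVec 1 m) :
    fderiv ℝ (fun Y : Config N => cellWave L m (Y l)) X
        (Pi.single j (EuclideanSpace.single a (1 : ℝ))) =
      if l = j then Complex.I * (k a : ℂ) * cellWave L m (X l) else 0 := by
  rw [fderiv_cellWave_comp_apply_eq L m l j X _ hk]
  have h : (∑ c : Fin 3, k c * (EuclideanSpace.single a (1 : ℝ) : Space) c) = k a := by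
    simp [PiLp.single_apply, Finset.sum_ite_eq']
  rw [h]

/-- `∂_{x_j·k} e_m(x_l) = δ_{lj} i ‖k‖² e_m(x_l)`. [folklore] -/
theorem fderiv_cellWave_comp_apply_waveVec (l j : Fin N) (X : Config N) {k : Space}
    (hk : k = (2 * Real.pi / L) • latticeVec 1 m) :
    fderiv ℝ (fun Y : Config N => cellWave L m (Y l)) X (Pi.single j k) =
      if l = j then Complex.I * ((‖k‖ ^ 2 : ℝ) : ℂ) * cellWave L m (X l) else 0 := by
  rw [fderiv_cellWave_comp_apply_eq L m l j X k hk]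
  have h : (∑ c : Fin 3, k c * k c) = ‖k‖ ^ 2 := by
    rw [EuclideanSpace.real_norm_sq_eq]
    exact Finset.sum_congr rfl fun c _ => by ring
  rw [h]

/-- Second coordinate derivative: `∂_{j,a}∂_{j,a} e_m(x_l) = δ_{lj} (i k_a)² e_m(x_l)`. [folklore] -/
theorem fderiv_fderiv_cellWave_comp_apply_single_single (l j : Fin N) (a : Fin 3) (X : Config N)
    {k : Space} (hk : k = (2 * Real.pi / L) • latticeVec 1 m) :
    fderiv ℝ (fun Y : Config N => fderiv ℝ (fun Z : Config N => cellWave L m (Z l)) Y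
        (Pi.single j (EuclideanSpace.single a (1 : ℝ)))) X
        (Pi.single j (EuclideanSpace.single a (1 : ℝ))) =
      if l = j then (Complex.I * (k a : ℂ)) ^ 2 * cellWave L m (X l) else 0 := by
  have h1 : (fun Y : Config N => fderiv ℝ (fun Z : Config N => cellWave L m (Z l)) Y
      (Pi.single j (EuclideanSpace.single a (1 : ℝ)))) =
      fun Y => if l = j then Complex.I * (k a : ℂ) * cellWave L m (Y l) else 0 :=
    funext fun Y => fderiv_cellWave_comp_apply_single_single L m l j a Y hk
  rw [h1]
  split_ifs with hlj
  · rw [fderiv_const_mul_apply' (differentiable_cellWave_comp_apply L m l X),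
      fderiv_cellWave_comp_apply_single_single L m l j a X hk, if_pos hlj]
    ring
  · simp

/-- **Laplacian of a modulated amplitude** (the commutator `[-Δ, e^{ik·x_l}]`): for `w ∈ C²`,
`Δ(e_m(x_l) w) = e_m(x_l) · (-‖k‖² w + 2i ∂_{x_l·k} w + Δw)` with `Δ = ∑_{i,a} ∂_{i,a}∂_{i,a}`.
[cite: Stringari1995, §2.3 (20)] -/
theorem laplacian_cellWave_mul (l : Fin N) {k : Space} (hk : k = (2 * Real.pi / L) • latticeVec 1 m)
    {w : Config N → ℂ} (hw : ContDiff ℝ 2 w) (X : Config N) :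
    ∑ i : Fin N, ∑ a : Fin 3,
        fderiv ℝ (fun Y : Config N => fderiv ℝ (fun Z : Config N => cellWave L m (Z l) * w Z) Y
          (Pi.single i (EuclideanSpace.single a (1 : ℝ)))) X
          (Pi.single i (EuclideanSpace.single a (1 : ℝ))) =
      cellWave L m (X l) * (-((‖k‖ ^ 2 : ℝ) : ℂ) * w X + 2 * Complex.I * fderiv ℝ w X (Pi.single l k) +
        ∑ i : Fin N, ∑ a : Fin 3,
          fderiv ℝ (fun Y : Config N => fderiv ℝ w Y (Pi.single i (EuclideanSpace.single a (1 : ℝ)))) X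
            (Pi.single i (EuclideanSpace.single a (1 : ℝ)))) := by
  have he2 : ContDiff ℝ 2 (fun Z : Config N => cellWave L m (Z l)) := contDiff_cellWave_comp_apply L m l
  -- each term of the Laplacian
  have hterm : ∀ (i : Fin N) (a : Fin 3),
      fderiv ℝ (fun Y : Config N => fderiv ℝ (fun Z : Config N => cellWave L m (Z l) * w Z) Y
          (Pi.single i (EuclideanSpace.single a (1 : ℝ)))) X
          (Pi.single i (EuclideanSpace.single a (1 : ℝ))) =
        (if l = i then (Complex.I * (k a : ℂ)) ^ 2 * cellWave L m (X l) else 0) * w X +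
          2 * ((if l = i then Complex.I * (k a : ℂ) * cellWave L m (X l) else 0) *
            fderiv ℝ w X (Pi.single i (EuclideanSpace.single a (1 : ℝ)))) +
          cellWave L m (X l) * fderiv ℝ (fun Y : Config N => fderiv ℝ w Y
            (Pi.single i (EuclideanSpace.single a (1 : ℝ)))) X
            (Pi.single i (EuclideanSpace.single a (1 : ℝ))) := by
    intro i a
    rw [fderiv_fderiv_mul_apply he2 hw, fderiv_fderiv_cellWave_comp_apply_single_single L m l i a X hk,
      fderiv_cellWave_comp_apply_single_single L m l i a X hk]
  simp_rw [hterm]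
  simp only [Finset.sum_add_distrib]
  -- the sums over the axes
  have hk2 : ∑ a : Fin 3, (Complex.I * (k a : ℂ)) ^ 2 = -((‖k‖ ^ 2 : ℝ) : ℂ) := by
    rw [EuclideanSpace.real_norm_sq_eq]
    push_cast
    rw [← Finset.sum_neg_distrib]
    refine Finset.sum_congr rfl fun a _ => ?_
    rw [mul_pow, Complex.I_sq]
    ring
  have hS1 : ∑ i : Fin N, ∑ a : Fin 3,
      (if l = i then (Complex.I * (k a : ℂ)) ^ 2 * cellWave L m (X l) else 0) * w X =
      -((‖k‖ ^ 2 : ℝ) : ℂ) * cellWave L m (X l) * w X := by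
    rw [Finset.sum_eq_single l (fun i _ hi => by simp [Ne.symm hi])
      (fun h => absurd (Finset.mem_univ l) h)]
    simp only [if_true, ← Finset.sum_mul, hk2]
  have hS2 : ∑ i : Fin N, ∑ a : Fin 3,
      2 * ((if l = i then Complex.I * (k a : ℂ) * cellWave L m (X l) else 0) *
        fderiv ℝ w X (Pi.single i (EuclideanSpace.single a (1 : ℝ)))) =
      2 * Complex.I * cellWave L m (X l) * fderiv ℝ w X (Pi.single l k) := by
    rw [Finset.sum_eq_single l (fun i _ hi => by simp [Ne.symm hi])
      (fun h => absurd (Finset.mem_univ l) h)]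
    simp only [if_true]
    rw [fderiv_apply_single_eq_sum, Finset.mul_sum]
    refine Finset.sum_congr rfl fun a _ => ?_
    rw [Complex.real_smul]
    ring
  have hS3 : ∑ i : Fin N, ∑ a : Fin 3, cellWave L m (X l) *
      fderiv ℝ (fun Y : Config N => fderiv ℝ w Y (Pi.single i (EuclideanSpace.single a (1 : ℝ)))) X
        (Pi.single i (EuclideanSpace.single a (1 : ℝ))) =
      cellWave L m (X l) * ∑ i : Fin N, ∑ a : Fin 3,
        fderiv ℝ (fun Y : Config N => fderiv ℝ w Y (Pi.single i (EuclideanSpace.single a (1 : ℝ)))) X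
          (Pi.single i (EuclideanSpace.single a (1 : ℝ))) := by
    rw [Finset.mul_sum]
    exact Finset.sum_congr rfl fun i _ => (Finset.mul_sum _ _ _).symm
  rw [hS1, hS2, hS3]
  ring

end PlaneWave

/-! ### The pair phase `E_{jl} = eⱼ ēₗ` -/

section PairPhase

variable (L : ℝ) (m : Fin 3 → ℤ) {k : Space}

/-- `∂_{x_j·k} (eⱼ ēₗ) = i α_{jl} eⱼ ēₗ` with `α_{jl} = ‖k‖²` for `j ≠ l`, `α_{jj} = 0`. [folklore] -/
theorem fderiv_pairPhase_left (hk : k = (2 * Real.pi / L) • latticeVec 1 m) (j l : Fin N)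
    (X : Config N) :
    fderiv ℝ (fun Y : Config N => cellWave L m (Y j) * conj (cellWave L m (Y l))) X (Pi.single j k) =
      Complex.I * (((if j = l then (0 : ℝ) else ‖k‖ ^ 2) : ℝ) : ℂ) *
        (cellWave L m (X j) * conj (cellWave L m (X l))) := by
  have hd := differentiable_cellWave_comp_apply L m (N := N)
  have hdc : DifferentiableAt ℝ (fun Y : Config N => conj (cellWave L m (Y l))) X :=
    (Complex.conjCLE.differentiable.differentiableAt).comp X (hd l X)
  rw [fderiv_mul_apply (hd j X) hdc, fderiv_conj_apply (hd l X),
    fderiv_cellWave_comp_apply_waveVec L m j j X hk, fderiv_cellWave_comp_apply_waveVec L m l j X hk,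
    if_pos rfl]
  by_cases hjl : j = l
  · subst hjl
    rw [if_pos rfl, if_pos rfl, map_mul, map_mul, Complex.conj_I, Complex.conj_ofReal]
    push_cast
    ring
  · rw [if_neg (Ne.symm hjl), if_neg hjl, map_zero]
    ring

/-- `∂_{x_l·k} (eⱼ ēₗ) = -i α_{jl} eⱼ ēₗ`. [folklore] -/
theorem fderiv_pairPhase_right (hk : k = (2 * Real.pi / L) • latticeVec 1 m) (j l : Fin N)
    (X : Config N) :
    fderiv ℝ (fun Y : Config N => cellWave L m (Y j) * conj (cellWave L m (Y l))) X (Pi.single l k) =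
      -(Complex.I * (((if j = l then (0 : ℝ) else ‖k‖ ^ 2) : ℝ) : ℂ)) *
        (cellWave L m (X j) * conj (cellWave L m (X l))) := by
  have hd := differentiable_cellWave_comp_apply L m (N := N)
  have hdc : DifferentiableAt ℝ (fun Y : Config N => conj (cellWave L m (Y l))) X :=
    (Complex.conjCLE.differentiable.differentiableAt).comp X (hd l X)
  rw [fderiv_mul_apply (hd j X) hdc, fderiv_conj_apply (hd l X),
    fderiv_cellWave_comp_apply_waveVec L m j l X hk, fderiv_cellWave_comp_apply_waveVec L m l l X hk,
    if_pos rfl]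
  by_cases hjl : j = l
  · subst hjl
    rw [if_pos rfl, if_pos rfl, map_mul, map_mul, Complex.conj_I, Complex.conj_ofReal]
    push_cast
    ring
  · rw [if_neg hjl, if_neg hjl, map_mul, map_mul, Complex.conj_I, Complex.conj_ofReal]
    ring

/-- The pair phase is smooth. [folklore] -/
theorem contDiff_pairPhase {n : ℕ∞} (j l : Fin N) :
    ContDiff ℝ n (fun Y : Config N => cellWave L m (Y j) * conj (cellWave L m (Y l))) :=
  (contDiff_cellWave_comp_apply L m j).mul (Complex.conjCLE.contDiff.comp (contDiff_cellWave_comp_apply L m l))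

end PairPhase

end Literature.MathematicalPhysics.QuantumManyBody.BoseGas

end
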